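import Summits.QuantumFields.YangMills.Theorems.BalabanUVNodesN15CurvedLocalSpeciesOfReg335UN
import HarnessLib

/-!
# Route «BalabanUVNodes» (cluster K4 «SpineRates»), Track-A DAG node N15 = NE2, BACKGROUND LAYER — THE LOCAL COEFFICIENT LETTERS OF THE CUBE SPECIES FROM (3.35) ON THE CUBE:
# pointwise row letters of the exact coefficients `a^±_μ(x)`, `c(x)` of `gaugePair τ S` (hypotheses AT THE SITE), the `U(n)` entry letters at a site, and — from lit-balaban r06's class
# `Reg335Cube` on a SET `Q` — a gauge UNITARY EVERYWHERE (the class's gauge on `Q`, `1` off `Q`) whose transformed bond variables obey those letters on the one-step interior of `Q`: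
# the producer of the displayed `hu`∕`hCloc`∕`hAloc` of dag-n15-w3's knit-ready `U(m)` corollaries p644977∕p645968

Cell `pub-ymgap`, seat `pub-ymgap-dag-n15-w2` (WIDTH SEAT 2∕3 on node N15, director-ym №197 ∕ HUMAN RULING D-0149), g6, fifth piece (bus CLAIM-5 I.40662; located by dag-n15-w3 g5's ■
I.≈40640 «REMAINS … (b) the (3.35) row letters `r_V` of `tCoefC∕tCoefA(u_kUu_kᴴ)` where `χ_k ≠ 0`»).  `bears_on: R4∕N15 · K3⁸ SpineGivenEndpointR13SepCoPHV (stmt-QuantumFields-27366)`.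
Filed `--kind proof --supports stmt-QuantumFields-27366 --as helper` — COUNT-NEUTRAL.  Theorems only; 0 `def`, 0 `sorry`.  Imports BY NAME this seat's g6 FILE 1
`…CurvedLocalSpeciesOfReg335UN` (`uN_opLetters_of_gauge335`, `uN_mem_unitaryGroup_of_norm_le_one`, `uN_val_gaugeTr_eq`; through it g5 FILE 2 `uN_abs_coordMat_conj_sub_entry_le` ∕
`coordMat_conj_one`, g5 FILE 11 `uN_gaugeTransformed_bond_unitary`, g5 FILE 1 `covShiftDefect_one`, g5 FILE 3 `frobenius_norm_le_sqrt_card_mul_l2_opNorm`, g2 `uN_coordMat_conj_orthogonal`,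
dag-n15-w3 file 1 `gaugePair(_inl∕_inr)` ∕ `curvCoefC_one` ∕ `curvCoefC_eq_cancel`, dag-n15-c FILE 28 `tCoefA(_inl∕_inr)` ∕ `tCoefC`, lit-balaban r06 `Reg335Cube` ∕ `gaugeTr` ∕ `fluct` ∕ `covD`)
and Mathlib `Set.piecewise`; nothing in the tree is modified, no landed name re-declared.

WHY.  dag-n15-w3 g5's knit-ready `U(m)` corollaries for Bałaban's covariant operator `Δ_{R_U} + P` with per-cube unitary gauges (p644977 `uN_hasMaj_glueInv_smoothCutDressed_localGauges` ∕
`uN_glueInv_smoothCutDressed_localGauges_inverse`, p645968 two grids) take, per cube `k`, a site gauge `u_k` UNITARY ON THE WHOLE CARRIER (`hu`) and the LOCAL species letters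
`hCloc : ∀ x, χ_k x ≠ 0 → ∀ i, Σ_j|tCoefC η (gaugePair τ (coordMat e (Ad_{u_k(·)U_μ(·)u_k(·+e_μ)ᴴ}))) x i j| ≤ r_V`, `hAloc` (the same for `tCoefA … j′ x`) — DISPLAYED there and located at this
lineage (n15-w3 ■ I.≈40640).  FILE 1 of this generation gave the two (3.35) bond letters from r06's class with the class's gauge on the class's set, and g5 FILE 11 the GLOBAL species
letter; the knit wants the COEFFICIENT ROWS, AT THE SITES of the cube only, in a gauge that is unitary everywhere.  THIS FILE supplies exactly that:
* §1 (real orthogonal transporter fields `S`, base `R ≡ 1`) POINTWISE rows — dag-n15-w3 file 1's §4 letters restated with hypotheses AT THE SITE instead of on the whole carrier: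
  ★ `rowSum_tCoefA_inl_le_at` (`|(S_μ(x) − 1)_{ij}| ≤ ηp ⟹ Σ_j|a⁺_μ(x)_{ij}| ≤ |κ|p`), ★ `rowSum_tCoefA_inr_le_at` (from the letter at `x − e_μ`), ★★ `rowSum_tCoefC_le_at` (orthogonal `S`:
  n15-w3's cancellation `c = −η⁻²Σ_μ[(1 − S_μ)(1 − S_μ)ᵀ + (S_μ(x) − S_μ(x − e_μ))ᵀ]` + the first letter at `x` and the plain backward-difference letter `≤ η²q` at `x` ⟹
  `Σ_j|c(x)_{ij}| ≤ |κ||J|(|κ|p² + q)` — the `(Lʲη)⁻²` structure of (3.52)).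
* §2 (`M_n(ℂ)`) `uN_abs_coordMat_conj_sub_one_entry_le_op`, `uN_abs_coordMat_conj_sub_conj_entry_le_op` — entry letters of `coordMat e (Ad_W) − 1` and of a difference of two
  transporters from the OPERATOR-norm distances (`κ_e·2√|n|·√|n|·‖·‖_{op}`; g5 FILE 2's pointwise lemma + g5 FILE 3's norm bridge).
* §3 ★★★ `uN_localCoefLetters_of_gauge335` — a gauge datum `(u, A)` AS IN THE CLASS on a set `Q`, read in ANY site field `w` unitary everywhere and equal to `u` on `Q`: at every
  `x` of the one-step interior of `Q` (`x, x ± e_μ ∈ Q`), `Σ_j|tCoefA … j′ x i j| ≤ |κ|·p` and `Σ_j|tCoefC … x i j| ≤ |κ||J|(|κ|p² + q)` with `p = κ_e·2√|n|·√|n|·(C∕ξ)e^{ηC∕ξ}`,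
  `q = κ_e·2√|n|·√|n|·(C∕ξ²)e^{ηC∕ξ}`; ★★★ **`uN_exists_gauge_localCoefLetters_of_reg335Cube`** — from `Reg335Cube τ U η Q ξ C` BY NAME: `w := Q.piecewise u 1` is unitary everywhere
  (p643533 §0 on `Q`) and the letters hold on the interior — p644977's `hu k` AND `hCloc k`∕`hAloc k` from ONE class datum per cube with `supp χ_k ⊆` interior of `Q_k`,
  `r_V := max` of the two bounds; ★★ `uN_exists_gauge_cutCoefLetters_of_reg335Cube` — the same in the consumer's literal shape (`χ x ≠ 0 → …`, one `r_V`).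

HONEST FRAMING ∕ LIMITS.  Pointwise re-editions of landed letters + `Set.piecewise` bookkeeping; the class (3.35) per cube is the HYPOTHESIS (as in [B9] Thm 3.1 ∕ Cor. 3.6); constants
crude (`√|n|`); the CUT FITS `o_V` across `π` and the gauge fit `o_W` of p645968 remain PAIRING DATA (not producible from (3.35) of one grid); nothing of [B5]∕[B6]∕[B9] asserted beyond
cited shapes; NE2⁺ NOT PRINTED ∕ NOT proved; N15 NOT discharged; K3⁸ OPEN, skeleton v6 untouched (0∕2); counts of record UNMOVED (typed 28∕28 · discharged 5∕27 · A 5∕28); one finite 𝕋⁴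
at fixed ε — NOT ℝ⁴ ∕ OS ∕ mass gap ∕ Clay; R4 closes the conditional finite-𝕋⁴ rung `BalabanLadder.UV` only.  Restate-immune (no Theses import).
-/

set_option autoImplicit false

noncomputable section
open scoped BigOperators Matrix
open Finset

namespace Summit.QuantumFields.YangMills.BalabanUVNodes.N15.CurvedSpecies

open Summit.QuantumFields.YangMills.BalabanUVNodes.N15.BackgroundLayer (tCoefA tCoefC tCoefA_inl tCoefA_inr)

/-! ## §1 POINTWISE row letters of the exact coefficients of `gaugePair τ S` (hypotheses at the site, not on the whole carrier) -/

section Pointwise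

variable {X J κ : Type} [Fintype κ] [DecidableEq κ] [Fintype J] (η : ℝ) (τ : J → X ≃ X) (S : J → X → Matrix κ κ ℝ)

omit [Fintype J] in
/-- ★ **FORWARD COEFFICIENT, AT A SITE**: `|(S_μ(x) − 1)_{ij}| ≤ ηp` for all `i, j` ⟹ `Σ_j |a⁺_μ(x)_{ij}| ≤ |κ|·p`, `a⁺_μ = η⁻¹(S_μ − 1)` (`η > 0`) — the pointwise edition of
n15-w3 file 1's `rowSum_curvCoefA_inl_le` (there the letter is assumed at every site). [cite: Balaban1985BackgroundPropagators, (3.51)–(3.52) p.400, (3.35) p.396 (shapes)] -/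
theorem rowSum_tCoefA_inl_le_at {p : ℝ} (hη : 0 < η) {μ : J} {x : X} (hS : ∀ i j, |(S μ x - 1) i j| ≤ η * p) (i : κ) :
    ∑ j, |tCoefA η (gaugePair τ S) (Sum.inl μ) x i j| ≤ Fintype.card κ * p := by
  simp only [tCoefA_inl, gaugePair_inl, Matrix.smul_apply, smul_eq_mul, abs_mul, abs_inv, abs_of_pos hη]
  calc ∑ j, η⁻¹ * |(S μ x - 1) i j| ≤ ∑ _j : κ, η⁻¹ * (η * p) :=
        Finset.sum_le_sum fun j _ => mul_le_mul_of_nonneg_left (hS i j) (inv_nonneg.2 hη.le)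
    _ = Fintype.card κ * p := by rw [Finset.sum_const, Finset.card_univ, nsmul_eq_mul, inv_mul_cancel_left₀ hη.ne']

omit [Fintype J] in
/-- ★ **BACKWARD COEFFICIENT, AT A SITE**: the letter at `x − e_μ`, `|(S_μ(x − e_μ) − 1)_{ij}| ≤ ηp`, gives `Σ_j |a⁻_μ(x)_{ij}| ≤ |κ|·p`, `a⁻_μ(x) = η⁻¹(1 − S_μ(x − e_μ)ᵀ)`.
[cite: Balaban1985BackgroundPropagators, (3.51)–(3.52) p.400, (3.35) p.396 (shapes)] -/
theorem rowSum_tCoefA_inr_le_at {p : ℝ} (hη : 0 < η) {μ : J} {x : X} (hS : ∀ i j, |(S μ ((τ μ).symm x) - 1) i j| ≤ η * p) (i : κ) :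
    ∑ j, |tCoefA η (gaugePair τ S) (Sum.inr μ) x i j| ≤ Fintype.card κ * p := by
  have hT : (1 : Matrix κ κ ℝ) - (S μ ((τ μ).symm x))ᵀ = -((S μ ((τ μ).symm x) - 1)ᵀ) := by
    rw [Matrix.transpose_sub, Matrix.transpose_one]; abel
  simp only [tCoefA_inr, gaugePair_inr, hT, Matrix.smul_apply, Matrix.neg_apply, Matrix.transpose_apply, smul_eq_mul, abs_mul, abs_inv, abs_of_pos hη,
    abs_neg]
  calc ∑ j, η⁻¹ * |(S μ ((τ μ).symm x) - 1) j i| ≤ ∑ _j : κ, η⁻¹ * (η * p) :=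
        Finset.sum_le_sum fun j _ => mul_le_mul_of_nonneg_left (hS j i) (inv_nonneg.2 hη.le)
    _ = Fintype.card κ * p := by rw [Finset.sum_const, Finset.card_univ, nsmul_eq_mul, inv_mul_cancel_left₀ hη.ne']

/-- ★★ **ZEROTH-ORDER COEFFICIENT, AT A SITE, WITH THE ORTHOGONALITY CANCELLATION**: for an orthogonal transporter field `S` (`S_μ(y)S_μ(y)ᵀ = 1` everywhere, so that n15-w3's
`curvCoefC_eq_cancel` at `R ≡ 1` reads `c = −η⁻²Σ_μ[(1 − S_μ)(1 − S_μ)ᵀ + (S_μ(x) − S_μ(x − e_μ))ᵀ]`, g5 `covShiftDefect_one`), the FIRST letter AT `x` (`|(S_μ(x) − 1)_{ij}| ≤ ηp`,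
all `μ`) and the PLAIN BACKWARD-DIFFERENCE letter AT `x` (`|(S_μ(x) − S_μ(x − e_μ))_{ij}| ≤ η²q`, all `μ`) give `Σ_j |c(x)_{ij}| ≤ |κ|·|J|·(|κ|p² + q)` — second order in the first
letter plus first order in the second, the `(L^jη)^{−2}` structure of (3.52); pointwise edition of n15-w3 file 1's `rowSum_curvCoefC_le`.
[cite: Balaban1985BackgroundPropagators, (3.52) p.400 (shape: `i[(D^{η*}_U A′)(x), ·] + F′`), (3.35) p.396] -/
theorem rowSum_tCoefC_le_at {p q : ℝ} (hη : 0 < η) (hp : 0 ≤ p) (hSo : ∀ μ y, S μ y * (S μ y)ᵀ = 1) {x : X}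
    (hS : ∀ μ i j, |(S μ x - 1) i j| ≤ η * p) (hD : ∀ μ i j, |(S μ x - S μ ((τ μ).symm x)) i j| ≤ η ^ 2 * q) (i : κ) :
    ∑ j, |tCoefC η (gaugePair τ S) x i j| ≤ Fintype.card κ * (Fintype.card J * (Fintype.card κ * p ^ 2 + q)) := by
  have hR : ∀ (_ : J) (_ : X), (1 : Matrix κ κ ℝ)ᵀ * 1 = 1 := fun _ _ => by rw [Matrix.transpose_one, Matrix.mul_one]
  have hc : tCoefC η (gaugePair τ S) x = -((η⁻¹ * η⁻¹) • ∑ μ, ((1 - S μ x) * (1 - S μ x)ᵀ + (S μ x - S μ ((τ μ).symm x))ᵀ)) := by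
    rw [← curvCoefC_one η τ S, curvCoefC_eq_cancel τ (fun _ _ => (1 : Matrix κ κ ℝ)) S η hSo hR x]
    simp only [covShiftDefect_one]
  -- entrywise
  have hentry : ∀ j, |tCoefC η (gaugePair τ S) x i j| ≤ Fintype.card J * (Fintype.card κ * p ^ 2 + q) := fun j => by
    rw [hc, Matrix.neg_apply, abs_neg, Matrix.smul_apply, smul_eq_mul, abs_mul, abs_mul, abs_inv, abs_of_pos hη, Matrix.sum_apply]
    have h1 : ∀ μ, |(((1 - S μ x) * (1 - S μ x)ᵀ + (S μ x - S μ ((τ μ).symm x))ᵀ : Matrix κ κ ℝ) i j)| ≤ Fintype.card κ * (η * p) ^ 2 + η ^ 2 * q := fun μ => by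
      rw [Matrix.add_apply, Matrix.transpose_apply]
      refine (abs_add_le _ _).trans (add_le_add ?_ (hD μ j i))
      rw [Matrix.mul_apply]
      refine (Finset.abs_sum_le_sum_abs _ _).trans ?_
      calc ∑ k, |(1 - S μ x) i k * (1 - S μ x)ᵀ k j| ≤ ∑ _k : κ, (η * p) * (η * p) := Finset.sum_le_sum fun k _ => by
              rw [abs_mul, Matrix.transpose_apply]
              have e1 : ∀ a b, |(1 - S μ x) a b| = |(S μ x - 1) a b| := fun a b => by
                rw [← abs_neg]; congr 1; simp [Matrix.sub_apply]
              rw [e1, e1]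
              exact mul_le_mul (hS μ i k) (hS μ j k) (abs_nonneg _) (by positivity)
        _ = Fintype.card κ * (η * p) ^ 2 := by rw [Finset.sum_const, Finset.card_univ, nsmul_eq_mul, sq]
    calc η⁻¹ * η⁻¹ * |∑ μ, (((1 - S μ x) * (1 - S μ x)ᵀ + (S μ x - S μ ((τ μ).symm x))ᵀ : Matrix κ κ ℝ) i j)|
        ≤ η⁻¹ * η⁻¹ * ∑ μ, |(((1 - S μ x) * (1 - S μ x)ᵀ + (S μ x - S μ ((τ μ).symm x))ᵀ : Matrix κ κ ℝ) i j)| := by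
          gcongr; exact Finset.abs_sum_le_sum_abs _ _
      _ ≤ η⁻¹ * η⁻¹ * ∑ _μ : J, (Fintype.card κ * (η * p) ^ 2 + η ^ 2 * q) := by gcongr with μ; exact h1 μ
      _ = Fintype.card J * (Fintype.card κ * p ^ 2 + q) := by
          rw [Finset.sum_const, Finset.card_univ, nsmul_eq_mul]; field_simp
  calc ∑ j, |tCoefC η (gaugePair τ S) x i j| ≤ ∑ _j : κ, Fintype.card J * (Fintype.card κ * p ^ 2 + q) := Finset.sum_le_sum fun j _ => hentry j
    _ = Fintype.card κ * (Fintype.card J * (Fintype.card κ * p ^ 2 + q)) := by rw [Finset.sum_const, Finset.card_univ, nsmul_eq_mul]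

end Pointwise

/-! ## §2 `M_n(ℂ)`: the entry letters of `S_μ(x) = coordMat e (Ad_{V_μ(x)})` AT A SITE from the group-level letters AT THAT SITE -/

section MatrixEntries

open scoped Matrix.Norms.L2Operator
open Summit.QuantumFields.YangMills.BalabanUVNodes.N15.MatrixSpecies (coordMat basisConst basisConst_nonneg)
open Literature.Barriers.QuantumFields (traceForm)

variable {n : Type} [Fintype n] [DecidableEq n] {κ : Type} [Fintype κ] [DecidableEq κ] (e : Matrix n n ℂ ≃L[ℝ] (κ → ℝ))

/-- ★ **ENTRY LETTER OF ONE TRANSPORTER FROM ITS OPERATOR-NORM DISTANCE TO `1`**: for a unitary `W`, `|(coordMat e (Ad_W) − 1)_{ij}| ≤ κ_e·2√|n|·√|n|·‖W − 1‖_{op}` (g5 FILE 2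
`uN_abs_coordMat_conj_sub_entry_le` at `(W, 1)` — a pointwise statement — and g5 FILE 3 `‖·‖_F ≤ √|n|‖·‖_{op}`; `κ_e` the Frobenius-currency `basisConst`). [cite: Balaban1985BackgroundPropagators, (3.35) p.396, (3.50) p.400 (shapes)] -/
theorem uN_abs_coordMat_conj_sub_one_entry_le_op {W : Matrix n n ℂ} (hW : Wᴴ * W = 1) (i j : κ) :
    |(coordMat e (ContinuousLinearMap.mulLeftRight ℝ (Matrix n n ℂ) W Wᴴ) - 1) i j| ≤
      @basisConst κ _ (Matrix n n ℂ) Matrix.frobeniusNormedAddCommGroup Matrix.frobeniusNormedSpace e * (2 * Real.sqrt (Fintype.card n)) * (Real.sqrt (Fintype.card n) * ‖W - 1‖) := by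
  have h1 : (1 : Matrix n n ℂ)ᴴ * 1 = 1 := by rw [Matrix.conjTranspose_one, Matrix.mul_one]
  have hκ := @basisConst_nonneg κ _ (Matrix n n ℂ) Matrix.frobeniusNormedAddCommGroup Matrix.frobeniusNormedSpace e
  rw [← coordMat_conj_one e]
  calc _ ≤ @basisConst κ _ (Matrix n n ℂ) Matrix.frobeniusNormedAddCommGroup Matrix.frobeniusNormedSpace e *
          (2 * Real.sqrt (Fintype.card n) * @Norm.norm _ Matrix.frobeniusSeminormedAddCommGroup.toNorm (W - 1)) := uN_abs_coordMat_conj_sub_entry_le e h1 hW i j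
    _ ≤ @basisConst κ _ (Matrix n n ℂ) Matrix.frobeniusNormedAddCommGroup Matrix.frobeniusNormedSpace e *
          (2 * Real.sqrt (Fintype.card n) * (Real.sqrt (Fintype.card n) * ‖W - 1‖)) :=
        mul_le_mul_of_nonneg_left (mul_le_mul_of_nonneg_left (frobenius_norm_le_sqrt_card_mul_l2_opNorm (W - 1)) (by positivity)) hκ
    _ = _ := by ring

/-- ★ **ENTRY LETTER OF A DIFFERENCE OF TWO TRANSPORTERS**: unitary `W, W′` ⟹ `|(coordMat e (Ad_{W′}) − coordMat e (Ad_W))_{ij}| ≤ κ_e·2√|n|·√|n|·‖W′ − W‖_{op}`.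
[cite: Balaban1985BackgroundPropagators, (3.35) p.396, (3.50) p.400 (shapes)] -/
theorem uN_abs_coordMat_conj_sub_conj_entry_le_op {W W' : Matrix n n ℂ} (hW : Wᴴ * W = 1) (hW' : W'ᴴ * W' = 1) (i j : κ) :
    |(coordMat e (ContinuousLinearMap.mulLeftRight ℝ (Matrix n n ℂ) W' W'ᴴ) - coordMat e (ContinuousLinearMap.mulLeftRight ℝ (Matrix n n ℂ) W Wᴴ)) i j| ≤
      @basisConst κ _ (Matrix n n ℂ) Matrix.frobeniusNormedAddCommGroup Matrix.frobeniusNormedSpace e * (2 * Real.sqrt (Fintype.card n)) * (Real.sqrt (Fintype.card n) * ‖W' - W‖) := by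
  have hκ := @basisConst_nonneg κ _ (Matrix n n ℂ) Matrix.frobeniusNormedAddCommGroup Matrix.frobeniusNormedSpace e
  calc _ ≤ @basisConst κ _ (Matrix n n ℂ) Matrix.frobeniusNormedAddCommGroup Matrix.frobeniusNormedSpace e *
          (2 * Real.sqrt (Fintype.card n) * @Norm.norm _ Matrix.frobeniusSeminormedAddCommGroup.toNorm (W' - W)) := uN_abs_coordMat_conj_sub_entry_le e hW hW' i j
    _ ≤ @basisConst κ _ (Matrix n n ℂ) Matrix.frobeniusNormedAddCommGroup Matrix.frobeniusNormedSpace e *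
          (2 * Real.sqrt (Fintype.card n) * (Real.sqrt (Fintype.card n) * ‖W' - W‖)) :=
        mul_le_mul_of_nonneg_left (mul_le_mul_of_nonneg_left (frobenius_norm_le_sqrt_card_mul_l2_opNorm (W' - W)) (by positivity)) hκ
    _ = _ := by ring

end MatrixEntries

/-! ## §3 From (3.35) on a SET `Q`: a globally unitary gauge and the local coefficient letters on the one-step interior of `Q` -/

section Local

open scoped Matrix.Norms.L2Operator
open Literature.MathematicalPhysics.QuantumFieldTheory.Balaban1983to89
open Literature.MathematicalPhysics.QuantumFieldTheory.Balaban1983to89.B9Eq39Adjoint (covD fluct)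
open Literature.MathematicalPhysics.QuantumFieldTheory.Balaban1983to89.B9Eq3117Current (gaugeTr)
open Literature.MathematicalPhysics.QuantumFieldTheory.Balaban1983to89.B9Eq335RegularityClasses (Reg335Cube)
open Summit.QuantumFields.YangMills.BalabanUVNodes.N15.MatrixSpecies (coordMat basisConst basisConst_nonneg)
open Literature.Barriers.QuantumFields (traceForm)

variable {n : Type} [Fintype n] [DecidableEq n] [Nonempty n] {κ : Type} [Fintype κ] [DecidableEq κ] (e : Matrix n n ℂ ≃L[ℝ] (κ → ℝ))
variable {X J : Type} [Fintype J] (τ : J → X ≃ X) (U : J → X → (Matrix n n ℂ)ˣ)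

/-- ★★★ **THE LOCAL COEFFICIENT LETTERS FROM A (3.35) GAUGE DATUM ON A SET, READ IN ANY GLOBALLY UNITARY EXTENSION OF THE GAUGE.**  `U(n)`-valued `U`; a gauge datum `(u, A)` AS IN
THE CLASS (3.35) on a set `Q` (u of unitary type on `Q`, `U^u = e^{iηA}` on `Q`, `‖A_κ‖ < Cξ⁻¹`, `‖η⁻¹D¹_κA_ν‖ < Cξ⁻²` on `Q`); `w` ANY site field, unitary EVERYWHERE and equal to
`u` on `Q`; `η, ξ > 0`, `C ≥ 0`.  Then at every site `x` of the ONE-STEP INTERIOR of `Q` (`x ∈ Q`, `x ± e_μ ∈ Q` for all `μ`) the exact coefficients of the transporters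
`S_μ(y) = coordMat e (Ad_{w(y)U_μ(y)w(y+e_μ)ᴴ})` (`Rp = gaugePair τ S`, the flat-base-point species of `U^w`) obey
`Σ_j|tCoefA η Rp j′ x i j| ≤ |κ|·p` (`j′` forward or backward) and `Σ_j|tCoefC η Rp x i j| ≤ |κ||J|(|κ|p² + q)` with `p = κ_e·2√|n|·√|n|·(C∕ξ)e^{ηC∕ξ}`,
`q = κ_e·2√|n|·√|n|·(C∕ξ²)e^{ηC∕ξ}` — FILE 1's two operator-norm letters on `Q` (§2 of p643533), §2's entry letters, §1's pointwise rows (the `c`-row through the orthogonality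
cancellation, `S` orthogonal everywhere because `w` and `U` are unitary everywhere).  These are p644977∕p645968's `hAloc k`∕`hCloc k` at every `x` with `χ_k(x) ≠ 0` once
`supp χ_k` sits in the one-step interior of the cube's `Q_k`. [cite: Balaban1985BackgroundPropagators, (3.35) p.396, (3.51)–(3.52) p.400, Cor. 3.6 p.408] -/
theorem uN_localCoefLetters_of_gauge335 (he : ∀ A B : Matrix n n ℂ, traceForm A B = e A ⬝ᵥ e B) {η : ℝ} (hη : 0 < η)
    (hU : ∀ μ x, (U μ x : Matrix n n ℂ) ∈ Matrix.unitaryGroup n ℂ) {Q : Set X} {ξ C : ℝ} (hξ : 0 < ξ) (hC : 0 ≤ C) {u : X → (Matrix n n ℂ)ˣ} {A : J → X → Matrix n n ℂ}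
    (hu1 : ∀ z ∈ Q, ‖(u z : Matrix n n ℂ)‖ ≤ 1 ∧ ‖(((u z)⁻¹ : (Matrix n n ℂ)ˣ) : Matrix n n ℂ)‖ ≤ 1) (hg : ∀ μ, ∀ z ∈ Q, gaugeTr τ u U μ z = fluct η A μ z)
    (hA : ∀ μ, ∀ z ∈ Q, ‖A μ z‖ < C * ξ⁻¹) (hD : ∀ μ ν, ∀ z ∈ Q, ‖((η : ℂ)⁻¹) • covD τ (fun _ _ => (1 : (Matrix n n ℂ)ˣ)) μ (A ν) z‖ < C * (ξ ^ 2)⁻¹)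
    {w : X → Matrix n n ℂ} (hw : ∀ y, (w y)ᴴ * w y = 1) (hwu : ∀ z ∈ Q, w z = (u z : Matrix n n ℂ)) {x : X} (hx : x ∈ Q) (hx1 : ∀ μ, τ μ x ∈ Q)
    (hx2 : ∀ μ, (τ μ).symm x ∈ Q) :
    (∀ j' i, ∑ j, |tCoefA η (gaugePair τ fun μ y => coordMat e (ContinuousLinearMap.mulLeftRight ℝ (Matrix n n ℂ) (w y * (U μ y : Matrix n n ℂ) * (w (τ μ y))ᴴ)
          (w y * (U μ y : Matrix n n ℂ) * (w (τ μ y))ᴴ)ᴴ)) j' x i j| ≤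
        Fintype.card κ * (@basisConst κ _ (Matrix n n ℂ) Matrix.frobeniusNormedAddCommGroup Matrix.frobeniusNormedSpace e * (2 * Real.sqrt (Fintype.card n)) *
          (Real.sqrt (Fintype.card n) * ((C / ξ) * Real.exp (η * (C / ξ)))))) ∧
      ∀ i, ∑ j, |tCoefC η (gaugePair τ fun μ y => coordMat e (ContinuousLinearMap.mulLeftRight ℝ (Matrix n n ℂ) (w y * (U μ y : Matrix n n ℂ) * (w (τ μ y))ᴴ)
          (w y * (U μ y : Matrix n n ℂ) * (w (τ μ y))ᴴ)ᴴ)) x i j| ≤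
        Fintype.card κ * (Fintype.card J *
          (Fintype.card κ * (@basisConst κ _ (Matrix n n ℂ) Matrix.frobeniusNormedAddCommGroup Matrix.frobeniusNormedSpace e * (2 * Real.sqrt (Fintype.card n)) *
              (Real.sqrt (Fintype.card n) * ((C / ξ) * Real.exp (η * (C / ξ))))) ^ 2 +
            @basisConst κ _ (Matrix n n ℂ) Matrix.frobeniusNormedAddCommGroup Matrix.frobeniusNormedSpace e * (2 * Real.sqrt (Fintype.card n)) *
              (Real.sqrt (Fintype.card n) * ((C / ξ ^ 2) * Real.exp (η * (C / ξ)))))) := by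
  -- the class letters on `Q` and unitarity of `u` there (FILE 1 §2)
  obtain ⟨huQ, h1, h2⟩ := uN_opLetters_of_gauge335 (T := τ) U (cube := Q) hη hu1 hg hA hD
  have hU' : ∀ μ y, ((U μ y : Matrix n n ℂ))ᴴ * (U μ y : Matrix n n ℂ) = 1 := fun μ y => Matrix.mem_unitaryGroup_iff'.mp (hU μ y)
  -- the transformed bond variables in the extension `w` are unitary everywhere, hence their transporters orthogonal everywhere
  set V : J → X → Matrix n n ℂ := fun μ y => w y * (U μ y : Matrix n n ℂ) * (w (τ μ y))ᴴ with hV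
  have hVu : ∀ μ y, (V μ y)ᴴ * V μ y = 1 := fun μ y => uN_gaugeTransformed_bond_unitary τ w (fun μ y => (U μ y : Matrix n n ℂ)) hw hU' μ y
  have hSo : ∀ μ y, coordMat e (ContinuousLinearMap.mulLeftRight ℝ (Matrix n n ℂ) (V μ y) (V μ y)ᴴ) *
      (coordMat e (ContinuousLinearMap.mulLeftRight ℝ (Matrix n n ℂ) (V μ y) (V μ y)ᴴ))ᵀ = 1 := fun μ y => (uN_coordMat_conj_orthogonal e he (hVu μ y)).2
  -- on bonds inside `Q` the extension reads the class gauge: `V_μ(z) = U^u_μ(z)` for `z, z + e_μ ∈ Q`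
  have hVg : ∀ μ z, z ∈ Q → τ μ z ∈ Q → V μ z = (gaugeTr τ u U μ z : Matrix n n ℂ) := fun μ z hz hz' => by
    rw [hV]; dsimp only
    rw [hwu z hz, hwu (τ μ z) hz', uN_val_gaugeTr_eq (T := τ) U (huQ (τ μ z) hz')]
  -- the two letters at the sites used
  set L₁ : ℝ := η * (C / ξ) * Real.exp (η * (C / ξ)) with hL₁
  set L₂ : ℝ := η ^ 2 * (C / ξ ^ 2) * Real.exp (η * (C / ξ)) with hL₂
  have hfirst : ∀ μ z, z ∈ Q → τ μ z ∈ Q → ‖V μ z - 1‖ ≤ L₁ := fun μ z hz hz' => by rw [hVg μ z hz hz']; exact h1 μ z hz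
  have hdiff : ∀ μ, ‖V μ x - V μ ((τ μ).symm x)‖ ≤ L₂ := fun μ => by
    have hy := hx2 μ
    have h := h2 μ μ ((τ μ).symm x) hy (by rwa [Equiv.apply_symm_apply])
    rw [Equiv.apply_symm_apply] at h
    rwa [hVg μ x hx (hx1 μ), hVg μ ((τ μ).symm x) hy (by rwa [Equiv.apply_symm_apply])]
  -- entry letters (§2)
  set kk : ℝ := @basisConst κ _ (Matrix n n ℂ) Matrix.frobeniusNormedAddCommGroup Matrix.frobeniusNormedSpace e * (2 * Real.sqrt (Fintype.card n)) with hkk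
  have hkk0 : 0 ≤ kk := mul_nonneg (@basisConst_nonneg κ _ (Matrix n n ℂ) Matrix.frobeniusNormedAddCommGroup Matrix.frobeniusNormedSpace e) (by positivity)
  have hsq : 0 ≤ Real.sqrt (Fintype.card n) := Real.sqrt_nonneg _
  have hE1 : ∀ μ z, z ∈ Q → τ μ z ∈ Q → ∀ i j, |(coordMat e (ContinuousLinearMap.mulLeftRight ℝ (Matrix n n ℂ) (V μ z) (V μ z)ᴴ) - 1) i j| ≤
      η * (kk * (Real.sqrt (Fintype.card n) * ((C / ξ) * Real.exp (η * (C / ξ))))) := fun μ z hz hz' i j => by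
    refine (uN_abs_coordMat_conj_sub_one_entry_le_op e (hVu μ z) i j).trans ?_
    calc kk * (Real.sqrt (Fintype.card n) * ‖V μ z - 1‖) ≤ kk * (Real.sqrt (Fintype.card n) * L₁) := by gcongr; exact hfirst μ z hz hz'
      _ = η * (kk * (Real.sqrt (Fintype.card n) * ((C / ξ) * Real.exp (η * (C / ξ))))) := by rw [hL₁]; ring
  have hE2 : ∀ μ i j, |(coordMat e (ContinuousLinearMap.mulLeftRight ℝ (Matrix n n ℂ) (V μ x) (V μ x)ᴴ) -
      coordMat e (ContinuousLinearMap.mulLeftRight ℝ (Matrix n n ℂ) (V μ ((τ μ).symm x)) (V μ ((τ μ).symm x))ᴴ)) i j| ≤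
      η ^ 2 * (kk * (Real.sqrt (Fintype.card n) * ((C / ξ ^ 2) * Real.exp (η * (C / ξ))))) := fun μ i j => by
    refine (uN_abs_coordMat_conj_sub_conj_entry_le_op e (hVu μ ((τ μ).symm x)) (hVu μ x) i j).trans ?_
    calc kk * (Real.sqrt (Fintype.card n) * ‖V μ x - V μ ((τ μ).symm x)‖) ≤ kk * (Real.sqrt (Fintype.card n) * L₂) := by gcongr; exact hdiff μ
      _ = η ^ 2 * (kk * (Real.sqrt (Fintype.card n) * ((C / ξ ^ 2) * Real.exp (η * (C / ξ))))) := by rw [hL₂]; ring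
  refine ⟨fun j' i => ?_, fun i => ?_⟩
  · cases j' with
    | inl μ => exact rowSum_tCoefA_inl_le_at η τ _ hη (hE1 μ x hx (hx1 μ)) i
    | inr μ => exact rowSum_tCoefA_inr_le_at η τ _ hη (hE1 μ ((τ μ).symm x) (hx2 μ) (by rwa [Equiv.apply_symm_apply])) i
  · exact rowSum_tCoefC_le_at η τ _ hη (by positivity) hSo (fun μ => hE1 μ x hx (hx1 μ)) (fun μ => hE2 μ) i

/-- ★★★ **THE SAME FROM THE CLASS (3.35) BY NAME, WITH THE CLASS's GAUGE EXTENDED BY `1` OFF THE SET** (∃-form): `U(n)`-valued `U` in r06's `Reg335Cube τ U η Q ξ C` on a set `Q`,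
`η, ξ > 0`, `C ≥ 0` ⟹ there is a site field `w`, UNITARY EVERYWHERE (the class's gauge on `Q` — unitary there by p643533 §0 — and `1` off `Q`; `Set.piecewise`, no definition), such
that the local coefficient letters of `uN_localCoefLetters_of_gauge335` hold at every site of the one-step interior of `Q` — p644977∕p645968's `hu k` (global unitarity) together with
`hAloc k`∕`hCloc k` (letters where `χ_k ≠ 0`) from ONE `Reg335Cube` datum per cube. [cite: Balaban1985BackgroundPropagators, (3.35) p.396, Cor. 3.6 p.408] -/
theorem uN_exists_gauge_localCoefLetters_of_reg335Cube (he : ∀ A B : Matrix n n ℂ, traceForm A B = e A ⬝ᵥ e B) {η : ℝ} (hη : 0 < η)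
    (hU : ∀ μ x, (U μ x : Matrix n n ℂ) ∈ Matrix.unitaryGroup n ℂ) {Q : Set X} {ξ C : ℝ} (hξ : 0 < ξ) (hC : 0 ≤ C) (h : Reg335Cube τ U η Q ξ C) :
    ∃ w : X → Matrix n n ℂ, (∀ y, (w y)ᴴ * w y = 1) ∧
      ∀ x, x ∈ Q → (∀ μ, τ μ x ∈ Q) → (∀ μ, (τ μ).symm x ∈ Q) →
        (∀ j' i, ∑ j, |tCoefA η (gaugePair τ fun μ y => coordMat e (ContinuousLinearMap.mulLeftRight ℝ (Matrix n n ℂ) (w y * (U μ y : Matrix n n ℂ) * (w (τ μ y))ᴴ)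
              (w y * (U μ y : Matrix n n ℂ) * (w (τ μ y))ᴴ)ᴴ)) j' x i j| ≤
            Fintype.card κ * (@basisConst κ _ (Matrix n n ℂ) Matrix.frobeniusNormedAddCommGroup Matrix.frobeniusNormedSpace e * (2 * Real.sqrt (Fintype.card n)) *
              (Real.sqrt (Fintype.card n) * ((C / ξ) * Real.exp (η * (C / ξ)))))) ∧
          ∀ i, ∑ j, |tCoefC η (gaugePair τ fun μ y => coordMat e (ContinuousLinearMap.mulLeftRight ℝ (Matrix n n ℂ) (w y * (U μ y : Matrix n n ℂ) * (w (τ μ y))ᴴ)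
              (w y * (U μ y : Matrix n n ℂ) * (w (τ μ y))ᴴ)ᴴ)) x i j| ≤
            Fintype.card κ * (Fintype.card J *
              (Fintype.card κ * (@basisConst κ _ (Matrix n n ℂ) Matrix.frobeniusNormedAddCommGroup Matrix.frobeniusNormedSpace e * (2 * Real.sqrt (Fintype.card n)) *
                  (Real.sqrt (Fintype.card n) * ((C / ξ) * Real.exp (η * (C / ξ))))) ^ 2 +
                @basisConst κ _ (Matrix n n ℂ) Matrix.frobeniusNormedAddCommGroup Matrix.frobeniusNormedSpace e * (2 * Real.sqrt (Fintype.card n)) *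
                  (Real.sqrt (Fintype.card n) * ((C / ξ ^ 2) * Real.exp (η * (C / ξ)))))) := by
  classical
  obtain ⟨u, A, hu1, hg, hA, hD⟩ := h
  have huQ : ∀ z ∈ Q, (u z : Matrix n n ℂ) ∈ Matrix.unitaryGroup n ℂ := fun z hz => uN_mem_unitaryGroup_of_norm_le_one (u z) (hu1 z hz).1 (hu1 z hz).2
  refine ⟨Q.piecewise (fun z => (u z : Matrix n n ℂ)) (fun _ => 1), fun y => ?_, fun x hx hx1 hx2 => ?_⟩
  · by_cases hy : y ∈ Q
    · rw [Set.piecewise_eq_of_mem _ _ _ hy]; exact Matrix.mem_unitaryGroup_iff'.mp (huQ y hy)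
    · rw [Set.piecewise_eq_of_notMem _ _ _ hy, Matrix.conjTranspose_one, Matrix.mul_one]
  · exact uN_localCoefLetters_of_gauge335 e τ U he hη hU hξ hC hu1 hg hA hD (w := Q.piecewise (fun z => (u z : Matrix n n ℂ)) (fun _ => 1))
      (fun y => by
        by_cases hy : y ∈ Q
        · rw [Set.piecewise_eq_of_mem _ _ _ hy]; exact Matrix.mem_unitaryGroup_iff'.mp (huQ y hy)
        · rw [Set.piecewise_eq_of_notMem _ _ _ hy, Matrix.conjTranspose_one, Matrix.mul_one])
      (fun z hz => Set.piecewise_eq_of_mem _ _ _ hz) hx hx1 hx2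

/-- ★★ **IN THE CONSUMER's SHAPE** (p644977's `hu k`, `hCloc k`, `hAloc k` literally): if the cut-off `χ` of the cube is supported in the one-step interior of the class's set `Q`
(`χ x ≠ 0 ⟹ x, x ± e_μ ∈ Q`) and `r_V` dominates the two bounds of `uN_exists_gauge_localCoefLetters_of_reg335Cube`, then there is a gauge `w` unitary everywhere with
`∀ x, χ x ≠ 0 → ∀ i, Σ_j|tCoefC … x i j| ≤ r_V` and `∀ j′ x, χ x ≠ 0 → ∀ i, Σ_j|tCoefA … j′ x i j| ≤ r_V`. [cite: Balaban1985BackgroundPropagators, (3.35) p.396, Cor. 3.6 p.408] -/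
theorem uN_exists_gauge_cutCoefLetters_of_reg335Cube (he : ∀ A B : Matrix n n ℂ, traceForm A B = e A ⬝ᵥ e B) {η : ℝ} (hη : 0 < η)
    (hU : ∀ μ x, (U μ x : Matrix n n ℂ) ∈ Matrix.unitaryGroup n ℂ) {Q : Set X} {ξ C : ℝ} (hξ : 0 < ξ) (hC : 0 ≤ C) (h : Reg335Cube τ U η Q ξ C) {χ : X → ℝ}
    (hχQ : ∀ x, χ x ≠ 0 → x ∈ Q ∧ (∀ μ, τ μ x ∈ Q) ∧ (∀ μ, (τ μ).symm x ∈ Q)) {rV : ℝ}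
    (hrA : Fintype.card κ * (@basisConst κ _ (Matrix n n ℂ) Matrix.frobeniusNormedAddCommGroup Matrix.frobeniusNormedSpace e * (2 * Real.sqrt (Fintype.card n)) *
      (Real.sqrt (Fintype.card n) * ((C / ξ) * Real.exp (η * (C / ξ))))) ≤ rV)
    (hrC : Fintype.card κ * (Fintype.card J *
      (Fintype.card κ * (@basisConst κ _ (Matrix n n ℂ) Matrix.frobeniusNormedAddCommGroup Matrix.frobeniusNormedSpace e * (2 * Real.sqrt (Fintype.card n)) *
          (Real.sqrt (Fintype.card n) * ((C / ξ) * Real.exp (η * (C / ξ))))) ^ 2 +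
        @basisConst κ _ (Matrix n n ℂ) Matrix.frobeniusNormedAddCommGroup Matrix.frobeniusNormedSpace e * (2 * Real.sqrt (Fintype.card n)) *
          (Real.sqrt (Fintype.card n) * ((C / ξ ^ 2) * Real.exp (η * (C / ξ)))))) ≤ rV) :
    ∃ w : X → Matrix n n ℂ, (∀ y, (w y)ᴴ * w y = 1) ∧
      (∀ x, χ x ≠ 0 → ∀ i, ∑ j, |tCoefC η (gaugePair τ fun μ y => coordMat e (ContinuousLinearMap.mulLeftRight ℝ (Matrix n n ℂ) (w y * (U μ y : Matrix n n ℂ) * (w (τ μ y))ᴴ)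
          (w y * (U μ y : Matrix n n ℂ) * (w (τ μ y))ᴴ)ᴴ)) x i j| ≤ rV) ∧
      ∀ j' x, χ x ≠ 0 → ∀ i, ∑ j, |tCoefA η (gaugePair τ fun μ y => coordMat e (ContinuousLinearMap.mulLeftRight ℝ (Matrix n n ℂ) (w y * (U μ y : Matrix n n ℂ) * (w (τ μ y))ᴴ)
          (w y * (U μ y : Matrix n n ℂ) * (w (τ μ y))ᴴ)ᴴ)) j' x i j| ≤ rV := by
  obtain ⟨w, hw, hL⟩ := uN_exists_gauge_localCoefLetters_of_reg335Cube e τ U he hη hU hξ hC h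
  refine ⟨w, hw, fun x hx i => ?_, fun j' x hx i => ?_⟩
  · obtain ⟨h0, h1, h2⟩ := hχQ x hx
    exact ((hL x h0 h1 h2).2 i).trans hrC
  · obtain ⟨h0, h1, h2⟩ := hχQ x hx
    exact ((hL x h0 h1 h2).1 j' i).trans hrA

end Local

end Summit.QuantumFields.YangMills.BalabanUVNodes.N15.CurvedSpecies

end
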